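import Mathlib
import Summits.CriticalPhenomena.CardyFormulaZ2.Theorems.CardyMagicRigidityNestingRigidityUVTiltTransferCollar
import Summits.CriticalPhenomena.CardyFormulaZ2.Theorems.CardyMagicRigidityNestingRigiditySmearedCentringZ2
import Summits.CriticalPhenomena.CardyFormulaZ2.Theorems.CardyMagicRigidityNestingRigidityBigLoopsFirstMoment
import HarnessLib

/-!
# Crux `NestingRigidity`, line `ring-cloud-tomography` (r5): the untilted first-moment identity on
# BOTH lattices, and the collar statistics of the tilt transfer (integrability, `Θ₂` domination)

Crux `Summit.CriticalPhenomena.CardyFormulaZ2.Theses.CardyMagicRigidity.NestingRigidity`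
(stmt-CriticalPhenomena-4835), line `ring-cloud-tomography`, stub R1'
`stub_uvDecoupling : ∀ E ∈ latticeEnsembles, UVDecoupling E`.  Hypothesis (L) of
`uvDecoupling_of_tilted_moments` concerns the additive UV statistic `Θ = Σ_{u ∉ tower} θ_u` and
`Θ₂ = Σ_{u ∉ tower} θ_u²`.  With the exact independence split (…UVTiltTransfer) and the pathwise
collar domination (…UVTiltTransferCollar) in hand, this file supplies the remaining DETERMINISTIC /
EXACT inputs of the reduction of (L) to collar first moments (no cited fact, no definition):

* §1 the UNTILTED FIRST-MOMENT IDENTITY `E_δ[Θ] = −t · E_δ[N_0(r,1)]` EXACTLY on BOTH lattice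
  ensembles (registered anchor `integral_uvPhase_latticeEnsembles`): on `𝕋` it is
  `FirstMoment.integral_uvPhase_tEns`; on `ℤ²` the same tower split plus the smeared exact
  centring of keystone K3 (`SmearedCentringZ2.integral_finsum_nestingPhase_eq_zero_zEns`:
  point reflections + self-duality of `P_{1/2}`);
* §2 the COLLAR STATISTIC `K = Σ_{u ∈ C_r} φ_u + #X + Σ_{u ∈ C_1} ψ_u` of
  `abs_uvPhaseBd_le_collar_latticeEnsembles` is measurable, uniformly bounded at fixed mesh, and
  `w^{N_0(r,1)} · K` is integrable for every real `w` (both lattices);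
* §3 the boundary part of `Θ₂` is dominated too: `Σ_{u ∈ B} θ_u² ≤ t² · K` pathwise
  (`θ_u² ≤ |t|·|θ_u|`);
* §4 the exact independence split for a GENERAL bounded statistic `g` of the non-tower loops
  (`θ`, `θ²`, …): `E_δ[w^N Σ_{∉ tower} g] = E_δ[w^N](E_δ[Σ_{∉ tower} g] − E_δ[Σ_B g]) + E_δ[w^N Σ_B g]`.
-/

noncomputable section

open MeasureTheory ProbabilityTheory Set Filter Metric
open scoped Real Topology BigOperators

namespace Summit.CriticalPhenomena.CardyFormulaZ2.Cruxes.NestingRigidity.RingCloudTomography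

open Literature.Probability.RandomPlanarGeometry Literature.Probability.Percolation
  Literature.Probability.LatticeModels
open Summit.CriticalPhenomena.CardyFormulaZ2.Cruxes.NestingRigidity.PositiveConeWeightDoubling
  (magicWeight meanTower coneCloud)

namespace TiltTransfer

/-! ## §1 The untilted first-moment identity on bond-`ℤ²` -/

/-- **Exact centring of the cone phases on `ℤ²`** (keystone K3 at the cone density): at every
mesh `δ > 0`, for every charge `t` and `0 < r ≤ 1`, `E_δ[Σ_{all loops} θ_u] = 0`. -/
theorem integral_finsum_nestingPhase_zEns {δ : ℝ} (hδ : 0 < δ) (t : ℝ) {r : ℝ} (hr : 0 < r)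
    (hr1 : r ≤ 1) :
    ∫ ω, (∑ᶠ u ∈ (zEns.X δ ω).loops, u.nestingPhase (coneCloud t r).density) ∂zEns.P = 0 :=
  SmearedCentringZ2.integral_finsum_nestingPhase_eq_zero_zEns
    (CloudAdmissibility.measurable_density _) (CloudAdmissibility.abs_density_le _)
    (fun _ hz ↦ ConeTilt.cone_density_eq_zero (𝔠 := coneCloud t r) rfl (by linarith) hz)
    (ConeTilt.integral_cone_density (𝔠 := coneCloud t r) rfl hr hr1) hδ

/-- **The untilted mean of the UV statistic on `ℤ²`, exactly**: `E_δ[Θ] = −t · E_δ[N_0(r,1)]`. -/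
theorem integral_uvPhase_zEns {δ : ℝ} (hδ : 0 < δ) (t : ℝ) {r : ℝ} (hr : 0 < r) (hr1 : r ≤ 1) :
    ∫ ω, (∑ᶠ u ∈ (zEns.X δ ω).loops \ {u ∈ (zEns.X δ ω).loops |
        Metric.closedBall (0 : ℂ) r ⊆ {z | u.wind z ≠ 0} ∧ u.range ⊆ Metric.ball (0 : ℂ) 1},
        u.nestingPhase (coneCloud t r).density) ∂zEns.P = -t * meanTower zEns δ r := by
  simp_rw [FirstMoment.finsum_sdiff_tower_nestingPhase_latticeEnsembles zEns zEns_mem hδ _ t hr hr1]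
  rw [integral_sub (FirstMoment.integrable_finsum_nestingPhase zEns zEns_mem hδ t hr hr1)
      ((FirstMoment.integrable_towerCount zEns zEns_mem hδ 0 r 1).const_mul t),
    integral_finsum_nestingPhase_zEns hδ t hr hr1, integral_const_mul]
  rw [show meanTower zEns δ r = ∫ ω, (towerCount (zEns.X δ ω) 0 r 1 : ℝ) ∂zEns.P from rfl]
  ring

/-! ## §2 The collar statistic: measurability, uniform bound, integrability -/

/-- **The collar statistic `K = Σ_{C_r} φ_u + #X + Σ_{C_1} ψ_u` is measurable** on both lattice
ensembles (finitary sums and counts over loop families cut out by deterministic predicates). -/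
theorem measurable_collar : ∀ E ∈ latticeEnsembles, ∀ (δ r : ℝ),
    Measurable fun ω ↦
      (∑ᶠ u ∈ {u ∈ (E.X δ ω).loops | (u.range ∩ closedBall (0 : ℂ) r).Nonempty ∧
          ¬ u.range ⊆ ball (0 : ℂ) (r - 2 * δ)}, ∫ z in {z | u.wind z ≠ 0}, discDensity 0 r z) +
        ({u ∈ (E.X δ ω).loops | closedBall (0 : ℂ) r ⊆ {z | u.wind z ≠ 0} ∧
          ¬ u.range ⊆ ball (0 : ℂ) 1 ∧
          (u.range ∩ closedBall (0 : ℂ) (1 + 2 * δ)).Nonempty}.ncard : ℝ) +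
        ∑ᶠ u ∈ {u ∈ (E.X δ ω).loops | (u.range ∩ closedBall (0 : ℂ) (1 + 2 * δ)).Nonempty ∧
          ¬ u.range ⊆ ball (0 : ℂ) 1}, ∫ z in {z | u.wind z ≠ 0}, annulusDensity 0 1 2 z :=
  fun E hE δ _ ↦
    ((FirstMoment.measurable_finsum_loops_sep E hE δ _ _).add
      (measurable_from_nat.comp (BigLoops.measurable_ncard_loops_sep E hE δ _))).add
      (FirstMoment.measurable_finsum_loops_sep E hE δ _ _)

/-- **At a fixed mesh the collar statistic is uniformly bounded** (all three families consist of
loops meeting `B̄(0, 1 + 2δ)`, finitely many uniformly in `ω`; `φ_u, ψ_u ∈ [0, 1]`). -/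
theorem exists_abs_collar_le : ∀ E ∈ latticeEnsembles, ∀ {δ : ℝ}, 0 < δ → ∀ {r : ℝ}, 0 < r →
    r ≤ 1 → ∃ B : ℝ, ∀ ω : E.Ω,
      |(∑ᶠ u ∈ {u ∈ (E.X δ ω).loops | (u.range ∩ closedBall (0 : ℂ) r).Nonempty ∧
          ¬ u.range ⊆ ball (0 : ℂ) (r - 2 * δ)}, ∫ z in {z | u.wind z ≠ 0}, discDensity 0 r z) +
        ({u ∈ (E.X δ ω).loops | closedBall (0 : ℂ) r ⊆ {z | u.wind z ≠ 0} ∧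
          ¬ u.range ⊆ ball (0 : ℂ) 1 ∧
          (u.range ∩ closedBall (0 : ℂ) (1 + 2 * δ)).Nonempty}.ncard : ℝ) +
        ∑ᶠ u ∈ {u ∈ (E.X δ ω).loops | (u.range ∩ closedBall (0 : ℂ) (1 + 2 * δ)).Nonempty ∧
          ¬ u.range ⊆ ball (0 : ℂ) 1}, ∫ z in {z | u.wind z ≠ 0}, annulusDensity 0 1 2 z| ≤ B := by
  intro E hE δ hδ r hr hr1
  obtain ⟨N, hN⟩ := FirstMoment.exists_ncard_loops_meeting_le E hE hδ (1 + 2 * δ)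
  refine ⟨N + N + N, fun ω ↦ ?_⟩
  obtain ⟨hfin, hle⟩ := hN ω
  have hφ1 : ∀ u : UnbasedLoop ℂ, |∫ z in {z | u.wind z ≠ 0}, discDensity 0 r z| ≤ 1 := fun u ↦ by
    have h := ConeTilt.setIntegral_discDensity_mem_Icc 0 hr {z | u.wind z ≠ 0}
    exact abs_le.2 ⟨by linarith [h.1], h.2⟩
  have hψ1 : ∀ u : UnbasedLoop ℂ, |∫ z in {z | u.wind z ≠ 0}, annulusDensity 0 1 2 z| ≤ 1 :=
    fun u ↦ by
    have h := ConeTilt.setIntegral_annulusDensity_mem_Icc 0 one_pos one_lt_two {z | u.wind z ≠ 0}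
    exact abs_le.2 ⟨by linarith [h.1], h.2⟩
  have hsub1 : {u ∈ (E.X δ ω).loops | (u.range ∩ closedBall (0 : ℂ) r).Nonempty ∧
      ¬ u.range ⊆ ball (0 : ℂ) (r - 2 * δ)} ∩
        Function.support (fun u : UnbasedLoop ℂ ↦ ∫ z in {z | u.wind z ≠ 0}, discDensity 0 r z) ⊆
      {u ∈ (E.X δ ω).loops | (u.range ∩ closedBall (0 : ℂ) (1 + 2 * δ)).Nonempty} := by
    rintro u ⟨⟨hu, ⟨p, hp, hpr⟩, -⟩, -⟩
    exact ⟨hu, p, hp, closedBall_subset_closedBall (by linarith) hpr⟩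
  have hsub3 : {u ∈ (E.X δ ω).loops | (u.range ∩ closedBall (0 : ℂ) (1 + 2 * δ)).Nonempty ∧
      ¬ u.range ⊆ ball (0 : ℂ) 1} ∩
        Function.support (fun u : UnbasedLoop ℂ ↦ ∫ z in {z | u.wind z ≠ 0}, annulusDensity 0 1 2 z) ⊆
      {u ∈ (E.X δ ω).loops | (u.range ∩ closedBall (0 : ℂ) (1 + 2 * δ)).Nonempty} :=
    fun u hu ↦ ⟨hu.1.1, hu.1.2.1⟩
  have h1 := FirstMoment.abs_finsum_mem_le hfin hsub1 zero_le_one hφ1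
  have h3 := FirstMoment.abs_finsum_mem_le hfin hsub3 zero_le_one hψ1
  have h2 : ({u ∈ (E.X δ ω).loops | closedBall (0 : ℂ) r ⊆ {z | u.wind z ≠ 0} ∧
      ¬ u.range ⊆ ball (0 : ℂ) 1 ∧ (u.range ∩ closedBall (0 : ℂ) (1 + 2 * δ)).Nonempty}.ncard : ℝ) ≤
      ({u ∈ (E.X δ ω).loops | (u.range ∩ closedBall (0 : ℂ) (1 + 2 * δ)).Nonempty}.ncard : ℝ) := by
    have hsub : {u ∈ (E.X δ ω).loops | closedBall (0 : ℂ) r ⊆ {z | u.wind z ≠ 0} ∧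
        ¬ u.range ⊆ ball (0 : ℂ) 1 ∧ (u.range ∩ closedBall (0 : ℂ) (1 + 2 * δ)).Nonempty} ⊆
        {u ∈ (E.X δ ω).loops | (u.range ∩ closedBall (0 : ℂ) (1 + 2 * δ)).Nonempty} :=
      fun u hu ↦ ⟨hu.1, hu.2.2.2⟩
    exact_mod_cast Set.ncard_le_ncard hsub hfin
  have hMN : ({u ∈ (E.X δ ω).loops |
      (u.range ∩ closedBall (0 : ℂ) (1 + 2 * δ)).Nonempty}.ncard : ℝ) ≤ N := by exact_mod_cast hle
  rw [one_mul] at h1 h3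
  have ha := abs_le.1 h1
  have hc := abs_le.1 h3
  rw [abs_le]
  constructor <;> nlinarith [ha.1, ha.2, hc.1, hc.2, h2, hMN,
    Nat.cast_nonneg (α := ℝ) {u ∈ (E.X δ ω).loops | closedBall (0 : ℂ) r ⊆ {z | u.wind z ≠ 0} ∧
      ¬ u.range ⊆ ball (0 : ℂ) 1 ∧ (u.range ∩ closedBall (0 : ℂ) (1 + 2 * δ)).Nonempty}.ncard]

/-- **Integrability of `w^{N_0(r,1)} · K`** on both lattices for EVERY real `w`, mesh `δ > 0` and
`0 < r ≤ 1` (bounded measurable integrand, probability law). -/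
theorem integrable_towerWeight_mul_collar : ∀ E ∈ latticeEnsembles, ∀ {δ : ℝ}, 0 < δ →
    ∀ (w : ℝ) {r : ℝ}, 0 < r → r ≤ 1 →
    Integrable (fun ω ↦ w ^ towerCount (E.X δ ω) 0 r 1 *
      ((∑ᶠ u ∈ {u ∈ (E.X δ ω).loops | (u.range ∩ closedBall (0 : ℂ) r).Nonempty ∧
          ¬ u.range ⊆ ball (0 : ℂ) (r - 2 * δ)}, ∫ z in {z | u.wind z ≠ 0}, discDensity 0 r z) +
        ({u ∈ (E.X δ ω).loops | closedBall (0 : ℂ) r ⊆ {z | u.wind z ≠ 0} ∧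
          ¬ u.range ⊆ ball (0 : ℂ) 1 ∧
          (u.range ∩ closedBall (0 : ℂ) (1 + 2 * δ)).Nonempty}.ncard : ℝ) +
        ∑ᶠ u ∈ {u ∈ (E.X δ ω).loops | (u.range ∩ closedBall (0 : ℂ) (1 + 2 * δ)).Nonempty ∧
          ¬ u.range ⊆ ball (0 : ℂ) 1}, ∫ z in {z | u.wind z ≠ 0}, annulusDensity 0 1 2 z)) E.P := by
  intro E hE δ hδ w r hr hr1
  haveI := isProbabilityMeasure_of_mem hE
  obtain ⟨B, hB⟩ := exists_abs_collar_le E hE hδ hr hr1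
  obtain ⟨N, hN⟩ := ConeTilt.exists_towerCount_le E hE hδ 0 r 1
  refine Integrable.of_bound
    (((measurable_towerCount E hE δ 0 r 1).const_pow w).mul
      (measurable_collar E hE δ r)).aestronglyMeasurable
    (max 1 |w| ^ N * B) (Eventually.of_forall fun ω ↦ ?_)
  rw [Real.norm_eq_abs, abs_mul, abs_pow]
  have hB0 : 0 ≤ B := (abs_nonneg _).trans (hB ω)
  exact mul_le_mul ((pow_le_pow_left₀ (abs_nonneg w) (le_max_right 1 |w|) _).trans
    (pow_le_pow_right₀ (le_max_left 1 |w|) (hN ω))) (hB ω) (abs_nonneg _) (by positivity)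

/-- The collar statistic itself is integrable (`w = 1`). -/
theorem integrable_collar : ∀ E ∈ latticeEnsembles, ∀ {δ : ℝ}, 0 < δ → ∀ {r : ℝ}, 0 < r → r ≤ 1 →
    Integrable (fun ω ↦
      (∑ᶠ u ∈ {u ∈ (E.X δ ω).loops | (u.range ∩ closedBall (0 : ℂ) r).Nonempty ∧
          ¬ u.range ⊆ ball (0 : ℂ) (r - 2 * δ)}, ∫ z in {z | u.wind z ≠ 0}, discDensity 0 r z) +
        ({u ∈ (E.X δ ω).loops | closedBall (0 : ℂ) r ⊆ {z | u.wind z ≠ 0} ∧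
          ¬ u.range ⊆ ball (0 : ℂ) 1 ∧
          (u.range ∩ closedBall (0 : ℂ) (1 + 2 * δ)).Nonempty}.ncard : ℝ) +
        ∑ᶠ u ∈ {u ∈ (E.X δ ω).loops | (u.range ∩ closedBall (0 : ℂ) (1 + 2 * δ)).Nonempty ∧
          ¬ u.range ⊆ ball (0 : ℂ) 1}, ∫ z in {z | u.wind z ≠ 0}, annulusDensity 0 1 2 z) E.P := by
  intro E hE δ hδ r hr hr1
  simpa only [one_pow, one_mul] using integrable_towerWeight_mul_collar E hE hδ 1 hr hr1

/-! ## §3 The boundary part of `Θ₂` -/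

/-- **The boundary part of `Θ₂` is dominated by the collar statistic**: on any configuration with
finitely many loops meeting `B̄(0, 1 + 2δ)` (`0 < r ≤ 1`, `δ ≥ 0`), `Σ_{u ∈ B} θ_u² ≤ t² · K`
(termwise `θ_u² ≤ |t|·|θ_u|` and `TiltTransfer.abs_indicator_bd_le`). -/
theorem uvPhaseSqBd_le_collar (c : LoopConfig ℂ) {t r δ : ℝ} (hr : 0 < r) (hr1 : r ≤ 1)
    (hδ : 0 ≤ δ)
    (hfin : {u ∈ c.loops | (u.range ∩ closedBall (0 : ℂ) (1 + 2 * δ)).Nonempty}.Finite) :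
    ∑ᶠ u ∈ {u ∈ c.loops |
        ¬ Disjoint u.range (closedBall (0 : ℂ) (1 + 2 * δ) \ ball 0 (r - 2 * δ)) ∧
          ¬ (closedBall (0 : ℂ) r ⊆ {z | u.wind z ≠ 0} ∧ u.range ⊆ ball (0 : ℂ) 1)},
        u.nestingPhase (coneCloud t r).density ^ 2 ≤
      t ^ 2 * ((∑ᶠ u ∈ {u ∈ c.loops | (u.range ∩ closedBall (0 : ℂ) r).Nonempty ∧
            ¬ u.range ⊆ ball (0 : ℂ) (r - 2 * δ)}, ∫ z in {z | u.wind z ≠ 0}, discDensity 0 r z) +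
        ({u ∈ c.loops | closedBall (0 : ℂ) r ⊆ {z | u.wind z ≠ 0} ∧ ¬ u.range ⊆ ball (0 : ℂ) 1 ∧
            (u.range ∩ closedBall (0 : ℂ) (1 + 2 * δ)).Nonempty}.ncard : ℝ) +
        ∑ᶠ u ∈ {u ∈ c.loops | (u.range ∩ closedBall (0 : ℂ) (1 + 2 * δ)).Nonempty ∧
            ¬ u.range ⊆ ball (0 : ℂ) 1}, ∫ z in {z | u.wind z ≠ 0}, annulusDensity 0 1 2 z) := by
  set M := {u ∈ c.loops | (u.range ∩ closedBall (0 : ℂ) (1 + 2 * δ)).Nonempty}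
  set Bd := {u ∈ c.loops |
      ¬ Disjoint u.range (closedBall (0 : ℂ) (1 + 2 * δ) \ ball 0 (r - 2 * δ)) ∧
        ¬ (closedBall (0 : ℂ) r ⊆ {z | u.wind z ≠ 0} ∧ u.range ⊆ ball (0 : ℂ) 1)} with hBd
  have hB : Bd ⊆ M := by
    rintro u ⟨hu, hA, -⟩
    obtain ⟨p, hp, hpA⟩ := Set.not_disjoint_iff.1 hA
    exact ⟨hu, p, hp, hpA.1⟩
  have hC : {u ∈ c.loops | (u.range ∩ closedBall (0 : ℂ) r).Nonempty ∧
      ¬ u.range ⊆ ball (0 : ℂ) (r - 2 * δ)} ⊆ M := by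
    rintro u ⟨hu, ⟨p, hp, hpr⟩, -⟩
    exact ⟨hu, p, hp, closedBall_subset_closedBall (by linarith) hpr⟩
  have hX : {u ∈ c.loops | closedBall (0 : ℂ) r ⊆ {z | u.wind z ≠ 0} ∧ ¬ u.range ⊆ ball (0 : ℂ) 1 ∧
      (u.range ∩ closedBall (0 : ℂ) (1 + 2 * δ)).Nonempty} ⊆ M := fun u hu ↦ ⟨hu.1, hu.2.2.2⟩
  have hC1 : {u ∈ c.loops | (u.range ∩ closedBall (0 : ℂ) (1 + 2 * δ)).Nonempty ∧
      ¬ u.range ⊆ ball (0 : ℂ) 1} ⊆ M := fun u hu ↦ ⟨hu.1, hu.2.1⟩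
  rw [finsum_mem_eq_sum_indicator hfin hB, finsum_mem_eq_sum_indicator hfin hC,
    ncard_eq_sum_indicator hfin hX, finsum_mem_eq_sum_indicator hfin hC1, ← Finset.sum_add_distrib,
    ← Finset.sum_add_distrib, Finset.mul_sum]
  refine Finset.sum_le_sum fun u _ ↦ ?_
  have h := abs_indicator_bd_le (c := c) (t := t) (δ := δ) hr u
  rw [← hBd] at h
  have hθ : |Bd.indicator (fun u : UnbasedLoop ℂ ↦ u.nestingPhase (coneCloud t r).density) u| ≤ |t| := by
    by_cases hu : u ∈ Bd
    · rw [Set.indicator_of_mem hu]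
      exact ConeTilt.abs_cone_nestingPhase_le (𝔠 := coneCloud t r) rfl hr u
    · rw [Set.indicator_of_notMem hu, abs_zero]
      exact abs_nonneg t
  have hsq : Bd.indicator (fun u : UnbasedLoop ℂ ↦ u.nestingPhase (coneCloud t r).density ^ 2) u =
      |Bd.indicator (fun u : UnbasedLoop ℂ ↦ u.nestingPhase (coneCloud t r).density) u| *
        |Bd.indicator (fun u : UnbasedLoop ℂ ↦ u.nestingPhase (coneCloud t r).density) u| := by
    rw [abs_mul_abs_self, ← pow_two]
    by_cases hu : u ∈ Bd
    · rw [Set.indicator_of_mem hu, Set.indicator_of_mem hu]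
    · rw [Set.indicator_of_notMem hu, Set.indicator_of_notMem hu, zero_pow two_ne_zero]
  rw [hsq, show t ^ 2 = |t| * |t| by rw [abs_mul_abs_self, pow_two], mul_assoc]
  exact mul_le_mul hθ h (abs_nonneg _) (abs_nonneg t)

/-! ## §4 The tilted moment of a general non-tower statistic through the split -/

/-- **The exact independence split for a general statistic** (both lattices, mesh `δ > 0`, every
real `w`): for every bounded `g` vanishing where the cone phase vanishes (e.g. `θ`, `θ²`),
`E_δ[w^N Σ_{u ∉ tower} g] = E_δ[w^N]·(E_δ[Σ_{u ∉ tower} g] − E_δ[Σ_{B} g]) + E_δ[w^N Σ_{B} g]`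
(pathwise split `loops ∖ tower = far ⊔ B` and independence of the far part from `N_0(r,1)`). -/
theorem integral_towerWeight_mul_finsum_sdiff_tower_eq_split : ∀ E ∈ latticeEnsembles, ∀ {δ : ℝ},
    0 < δ → ∀ (w t : ℝ) {r : ℝ}, 0 < r → r ≤ 1 → ∀ (g : UnbasedLoop ℂ → ℝ) {C : ℝ}, 0 ≤ C →
    (∀ u, |g u| ≤ C) → (∀ u : UnbasedLoop ℂ, u.nestingPhase (coneCloud t r).density = 0 → g u = 0) →
    ∫ ω, w ^ towerCount (E.X δ ω) 0 r 1 *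
        ∑ᶠ u ∈ (E.X δ ω).loops \ {u ∈ (E.X δ ω).loops |
          closedBall (0 : ℂ) r ⊆ {z | u.wind z ≠ 0} ∧ u.range ⊆ ball (0 : ℂ) 1}, g u ∂E.P =
      E.towerMoment w δ r *
          ((∫ ω, ∑ᶠ u ∈ (E.X δ ω).loops \ {u ∈ (E.X δ ω).loops |
              closedBall (0 : ℂ) r ⊆ {z | u.wind z ≠ 0} ∧ u.range ⊆ ball (0 : ℂ) 1}, g u ∂E.P) -
            ∫ ω, ∑ᶠ u ∈ {u ∈ (E.X δ ω).loops |
              ¬ Disjoint u.range (closedBall (0 : ℂ) (1 + 2 * δ) \ ball 0 (r - 2 * δ)) ∧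
                ¬ (closedBall (0 : ℂ) r ⊆ {z | u.wind z ≠ 0} ∧ u.range ⊆ ball (0 : ℂ) 1)},
                g u ∂E.P) +
        ∫ ω, w ^ towerCount (E.X δ ω) 0 r 1 *
          ∑ᶠ u ∈ {u ∈ (E.X δ ω).loops |
            ¬ Disjoint u.range (closedBall (0 : ℂ) (1 + 2 * δ) \ ball 0 (r - 2 * δ)) ∧
              ¬ (closedBall (0 : ℂ) r ⊆ {z | u.wind z ≠ 0} ∧ u.range ⊆ ball (0 : ℂ) 1)},
              g u ∂E.P := by
  intro E hE δ hδ w t r hr hr1 g C hC0 hC hg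
  set DF : UnbasedLoop ℂ → Prop := fun u ↦
    Disjoint u.range (closedBall (0 : ℂ) (1 + 2 * δ) \ ball 0 (r - 2 * δ))
  set DB : UnbasedLoop ℂ → Prop := fun u ↦
    ¬ Disjoint u.range (closedBall (0 : ℂ) (1 + 2 * δ) \ ball 0 (r - 2 * δ)) ∧
      ¬ (closedBall (0 : ℂ) r ⊆ {z | u.wind z ≠ 0} ∧ u.range ⊆ ball (0 : ℂ) 1)
  have hsplit : ∀ ω, ∑ᶠ u ∈ (E.X δ ω).loops \ {u ∈ (E.X δ ω).loops |
      closedBall (0 : ℂ) r ⊆ {z | u.wind z ≠ 0} ∧ u.range ⊆ ball (0 : ℂ) 1}, g u =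
      (∑ᶠ u ∈ {u ∈ (E.X δ ω).loops | DF u}, g u) + ∑ᶠ u ∈ {u ∈ (E.X δ ω).loops | DB u}, g u :=
    fun ω ↦ finsum_sdiff_tower_eq_far_add_bd_latticeEnsembles E hE hδ ω t hr hr1 g hg
  have hiF := integrable_finsum_sep E hE hδ t hr hr1 DF g hC0 hC hg
  have hiB := integrable_finsum_sep E hE hδ t hr hr1 DB g hC0 hC hg
  have hiwF := integrable_towerWeight_mul_finsum_sep E hE hδ w t hr hr1 DF g hC0 hC hg
  have hiwB := integrable_towerWeight_mul_finsum_sep E hE hδ w t hr hr1 DB g hC0 hC hg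
  have hint : ∫ ω, ∑ᶠ u ∈ (E.X δ ω).loops \ {u ∈ (E.X δ ω).loops |
      closedBall (0 : ℂ) r ⊆ {z | u.wind z ≠ 0} ∧ u.range ⊆ ball (0 : ℂ) 1}, g u ∂E.P =
      (∫ ω, ∑ᶠ u ∈ {u ∈ (E.X δ ω).loops | DF u}, g u ∂E.P) +
        ∫ ω, ∑ᶠ u ∈ {u ∈ (E.X δ ω).loops | DB u}, g u ∂E.P := by
    rw [← integral_add hiF hiB]
    exact integral_congr_ae (Eventually.of_forall hsplit)
  have hprod := integral_towerWeight_mul_finsum_far E hE hδ.le w r g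
  calc ∫ ω, w ^ towerCount (E.X δ ω) 0 r 1 *
        ∑ᶠ u ∈ (E.X δ ω).loops \ {u ∈ (E.X δ ω).loops |
          closedBall (0 : ℂ) r ⊆ {z | u.wind z ≠ 0} ∧ u.range ⊆ ball (0 : ℂ) 1}, g u ∂E.P
      = ∫ ω, (w ^ towerCount (E.X δ ω) 0 r 1 * ∑ᶠ u ∈ {u ∈ (E.X δ ω).loops | DF u}, g u) +
          w ^ towerCount (E.X δ ω) 0 r 1 * ∑ᶠ u ∈ {u ∈ (E.X δ ω).loops | DB u}, g u ∂E.P :=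
        integral_congr_ae (Eventually.of_forall fun ω ↦ by dsimp only; rw [hsplit ω, mul_add])
    _ = E.towerMoment w δ r * (∫ ω, ∑ᶠ u ∈ {u ∈ (E.X δ ω).loops | DF u}, g u ∂E.P) +
          ∫ ω, w ^ towerCount (E.X δ ω) 0 r 1 * ∑ᶠ u ∈ {u ∈ (E.X δ ω).loops | DB u}, g u ∂E.P := by
        rw [integral_add hiwF hiwB, hprod]
    _ = _ := by rw [hint]; ring

end TiltTransfer

/-- **The boundary part of `Θ₂` is dominated by the collar statistic on BOTH lattice ensembles**
(mesh `δ > 0`, every sample, charge `t`, `0 < r ≤ 1`): `Σ_{u ∈ B} θ_u² ≤ t² · K`. -/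
theorem uvPhaseSqBd_le_collar_latticeEnsembles : ∀ E ∈ latticeEnsembles, ∀ {δ : ℝ}, 0 < δ →
    ∀ (ω : E.Ω) (t : ℝ) {r : ℝ}, 0 < r → r ≤ 1 →
    ∑ᶠ u ∈ {u ∈ (E.X δ ω).loops |
        ¬ Disjoint u.range (Metric.closedBall (0 : ℂ) (1 + 2 * δ) \ Metric.ball 0 (r - 2 * δ)) ∧
          ¬ (Metric.closedBall (0 : ℂ) r ⊆ {z | u.wind z ≠ 0} ∧ u.range ⊆ Metric.ball (0 : ℂ) 1)},
        u.nestingPhase (coneCloud t r).density ^ 2 ≤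
      t ^ 2 * ((∑ᶠ u ∈ {u ∈ (E.X δ ω).loops | (u.range ∩ Metric.closedBall (0 : ℂ) r).Nonempty ∧
            ¬ u.range ⊆ Metric.ball (0 : ℂ) (r - 2 * δ)},
            ∫ z in {z | u.wind z ≠ 0}, discDensity 0 r z) +
        ({u ∈ (E.X δ ω).loops | Metric.closedBall (0 : ℂ) r ⊆ {z | u.wind z ≠ 0} ∧
            ¬ u.range ⊆ Metric.ball (0 : ℂ) 1 ∧
            (u.range ∩ Metric.closedBall (0 : ℂ) (1 + 2 * δ)).Nonempty}.ncard : ℝ) +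
        ∑ᶠ u ∈ {u ∈ (E.X δ ω).loops | (u.range ∩ Metric.closedBall (0 : ℂ) (1 + 2 * δ)).Nonempty ∧
            ¬ u.range ⊆ Metric.ball (0 : ℂ) 1},
            ∫ z in {z | u.wind z ≠ 0}, annulusDensity 0 1 2 z) :=
  fun E hE _ hδ ω _ _ hr hr1 ↦
    TiltTransfer.uvPhaseSqBd_le_collar _ hr hr1 hδ.le (ConeTilt.finite_loops_meeting E hE hδ ω _)

/-- **The UNTILTED first-moment identity behind hypothesis (L) of `uvDecoupling_of_tilted_moments`,
EXACTLY, on BOTH lattice ensembles** (registered helper toward stub R1' `stub_uvDecoupling`, line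
`ring-cloud-tomography` r5).  For `E ∈ latticeEnsembles`, every mesh `δ > 0`, charge `t` and
`0 < r ≤ 1`, the additive UV statistic `Θ = Σ_{u ∉ tower} θ_u` of the cone cloud has mean
`E_δ[Θ] = −t · E_δ[N_0(r,1)] = −t · meanTower E δ r`: pathwise `Θ = Σ_u θ_u − t N_0(r,1)` (every
tower loop has phase `t`) and `E_δ[Σ_u θ_u] = 0` identically — smeared exact centring on `𝕋`
(`MagicFormulaT.LineSketch.smearedCentring`) and on `ℤ²` (keystone K3 `smearedCentring_zEns`). -/
theorem integral_uvPhase_latticeEnsembles : ∀ E ∈ latticeEnsembles, ∀ {δ : ℝ}, 0 < δ →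
    ∀ (t : ℝ) {r : ℝ}, 0 < r → r ≤ 1 →
    ∫ ω, (∑ᶠ u ∈ (E.X δ ω).loops \ {u ∈ (E.X δ ω).loops |
        Metric.closedBall (0 : ℂ) r ⊆ {z | u.wind z ≠ 0} ∧ u.range ⊆ Metric.ball (0 : ℂ) 1},
        u.nestingPhase (coneCloud t r).density) ∂E.P = -t * meanTower E δ r := by
  intro E hE δ hδ t r hr hr1
  simp only [latticeEnsembles, Set.mem_insert_iff, Set.mem_singleton_iff] at hE
  rcases hE with rfl | rfl
  · exact TiltTransfer.integral_uvPhase_zEns hδ t hr hr1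
  · exact FirstMoment.integral_uvPhase_tEns hδ t hr hr1

end Summit.CriticalPhenomena.CardyFormulaZ2.Cruxes.NestingRigidity.RingCloudTomography

end
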